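import Summits.QuantumFields.BalabanUV.T4Continuum.Support.B13KPStepTermMeasurable
import Summits.QuantumFields.BalabanUV.T4Continuum.Support.B13KPStepTermLetters

/-!
# NE5 ∕ U3, route P2 — REPAIR R-b, part 4: THE MOST REDUCED NON-VACUOUS FACE of the activity route on Bałaban's carriers of record — the END
# on the measurable operator slot IN THE TERM DATA's LETTERS and IN THE B13 FORMAT (no `ReadLip`, no `Geometry` binder: per-term `Admissible` +
# `GeometryCore` + format letters + measurability side conditions + `RefAt` at both runs' input points + ONE (2.38)-shaped inequality)

Cell `pub-balaban`, unit `b2b-balaban-t4-ne5-p2` (NE5 ∕ U3 PROVER seat P2, lineage gen 19; owner RULING R17 «R-b NOW»).  Summits-side new work (cell bookkeeping;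
NOT a Literature module; nothing of the manuscripts is asserted).  HONEST FRAMING: rung (B)+1 of the FINITE-VOLUME T⁴ programme — NOT infinite volume, NOT mass
gap, NOT Clay, **NOT A PROOF OF NE5** (spine 0∕9); cores and constants are NAMED PARAMETERS.  HONEST DEPENDENCY (cell line, verbatim): continuum YM on T⁴ ⇐
BetaPertH ∧ nine spine estimates (0/9 proved); BetaPertH ⇐ (D1) ∧ (D4) ∧ CAP+tail; G-an2-4 gates asym, D1 and NE2/3/4.

WHAT.  `hsum_termMajorant_M`: for the term family of record ON `measOp` (part 3) the per-term majorants are those of A11's `G₀` (`ampOp_onSub` ∕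
`ampHist_onSub` are `rfl`), so A11's majorant of record `termMajorant 𝔖 𝔡` makes `hsum` an identity here too; **`ne5_above_max_record_measOp_letters`**:
part 3's `ne5_above_max_record_measOp` with `m := termMajorant` and `WellFormed` from `wellFormed_M_of_format` — displayed on the analytic side ONLY: per
catalogued term of record `Admissible`, `GeometryCore` (lattice part), the B13-format letters (`G.δ = 𝔡.δ`, ONE `𝐕″`-format domination, the margin
inequalities), the measurability side conditions (`hXf`∕`hBf`, data of record in `measOp`), `RefAt` at BOTH runs' own input points, and ONE (2.38)-shaped
inequality `Σ_ℓ G₀ Z ℓ ≤ A_m·e^{−R_m·d(Z)}` on every 𝐃_k; then W1∕W4∕W3 of the step of record, the transport reading, and the numerics.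
0 sorry; axioms ⊆ {propext, Classical.choice, Quot.sound}.
-/

noncomputable section

open MeasureTheory
open scoped BigOperators

namespace Summit.QuantumFields.BalabanUV.T4Continuum.B13KPStepTermMeasurableLetters

open Literature.MathematicalPhysics.QuantumFieldTheory.Balaban1983to89
open Literature.MathematicalPhysics.QuantumFieldTheory.Balaban1983to89.T4OutputRate (Carriers Functional DecayBound NE5)
open Literature.MathematicalPhysics.QuantumFieldTheory.Balaban1983to89.T4InputCauchyRateData (StepModel)
open Summit.QuantumFields.BalabanUV.T4Continuum.ActivityTermModel (TermDatum TermConsts TermFamily)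
open Summit.QuantumFields.BalabanUV.T4Continuum.B13Carriers (TwoRuns)
open Summit.QuantumFields.BalabanUV.T4Continuum.ClusterRepOfDomains (DomainGeometry)
open Summit.QuantumFields.BalabanUV.T4Continuum.B13DomainGeometryTR (domainGeometry)
open Summit.QuantumFields.BalabanUV.T4Continuum.B13InnerData (b13InnerData Bnd)
open Summit.QuantumFields.BalabanUV.T4Continuum.B13OpDatum (OpDatum Species B13Weights)
open Summit.QuantumFields.BalabanUV.T4Continuum.B13HistDatum (level136)
open Summit.QuantumFields.BalabanUV.T4Continuum.B13HistMeasurable (MeasPotFrame B13HistM)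
open Summit.QuantumFields.BalabanUV.T4Continuum.B13StepOfRecord (step outA outB assembly)
open Summit.QuantumFields.BalabanUV.T4Continuum.B13StepTermLabels (InnerLabel innerLabels)
open Summit.QuantumFields.BalabanUV.T4Continuum.B13KPStepOfRecord (inputA_KP inputB_KP)
open Summit.QuantumFields.BalabanUV.T4Continuum.B13TermData (TermCore termData)
open Summit.QuantumFields.BalabanUV.T4Continuum.B13StepOfRecordTermData (TermSlots)
open Summit.QuantumFields.BalabanUV.T4Continuum.B13OpMeasurable (measOp)
open Summit.QuantumFields.BalabanUV.T4Continuum.B13KPStepTermMeasurable (termFamilyM wellFormed_M_of_format ne5_above_max_record_measOp)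
open Summit.QuantumFields.BalabanUV.T4Continuum.B13KPStepTermLetters (G₀ termMajorant termMajorant_nonneg)

variable {𝔾 : Type} [GaugeGroup 𝔾] {R : TwoRuns 𝔾} {P : MeasPotFrame R.carriers} {𝒴 : Type*} {dom : 𝒴 → R.carriers.Dom}
  {T κ ι S Ω Ω₀ 𝒞 IOp : Type*} [MeasurableSpace Ω] [MeasurableSpace Ω₀] [Fintype ι] [Fintype κ] [DecidableEq ι] [DecidableEq κ]
  (𝔖 : TermSlots R P dom T κ ι S Ω Ω₀ 𝒞 IOp) (E₀ cB : ℝ)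
  (hA : ∀ g U k, (step 𝔖.toSlots E₀ cB).opA g U k ∈ measOp T κ ι Ω 𝒴)
  (hB : ∀ g U k, (step 𝔖.toSlots E₀ cB).opB g U k ∈ measOp T κ ι Ω 𝒴)
  (𝔡 : R.carriers.Dom → InnerLabel R.carriers.Dom (Bnd R) → TermConsts)

/-- [folklore] The per-term majorant of the family on the measurable slot IS A11's `G₀` (`rfl`: the amplitudes of the restricted datum are the ambient ones). -/
theorem G_termFamilyM_eq (Λop Λhist ρ₀ : ℝ) (g : ℕ → ℝ) (U : R.carriers.BgB) (X Z : R.carriers.Dom) (ℓ : InnerLabel R.carriers.Dom (Bnd R)) :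
    (termFamilyM 𝔖 E₀ cB hA hB 𝔡).G Λop Λhist ρ₀ g U X Z ℓ = G₀ 𝔖 𝔡 Λop Λhist ρ₀ Z ℓ := rfl

/-- [folklore] **`hsum` IS AN IDENTITY ON THE MEASURABLE SLOT** for A11's majorant of record `termMajorant`. -/
theorem hsum_termMajorant_M {Λop Λhist ρ₀ : ℝ} (W : Set (ℕ → ℝ)) :
    ∀ g ∈ W, ∀ (U : R.carriers.BgB) (X : R.carriers.Dom), ∀ Z ∈ (domainGeometry R).level (R.carriers.scale X),
      ∑ ℓ ∈ innerLabels (b13InnerData R) (R.carriers.scale X) Z, (termFamilyM 𝔖 E₀ cB hA hB 𝔡).G Λop Λhist ρ₀ g U X Z ℓ ≤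
        termMajorant 𝔖 𝔡 Λop Λhist ρ₀ g U Z := by
  intro g _ U X Z hZ
  have hsc : R.carriers.scale Z = R.carriers.scale X := ((domainGeometry R).mem_level Z _).1 hZ
  unfold termMajorant
  rw [hsc]
  rfl

variable [DecidableEq 𝒞]

include hA hB in
/-- [folklore] **THE MOST REDUCED NON-VACUOUS FACE OF ROUTE P2 ON BAŁABAN's CARRIERS OF RECORD** (part 3's `ne5_above_max_record_measOp` with
`m := termMajorant` and `WellFormed := wellFormed_M_of_format`).  DISPLAYED, analytic side, per catalogued term of record: `Admissible` constants (L04),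
the LATTICE geometry `GeometryCore` (L05), the B13-FORMAT LETTERS `G.δ = 𝔡.δ`, `G.v ≤ λR·(rHist·‖τ‖·level136)`, `rOp ≤ κL, κA, κP, κQ`, `rOp·λR ≤ κR`
(L05-read, instancer's letters), the measurability side conditions `hXf`∕`hBf` (Gaussian coordinates of the cores) and `hA`∕`hB` (data of record in the
measurable slot ⟸ `op[A|B]_mem_measOp_of_raw`), route P2's reference data `RefAt` at BOTH runs' own input points (L06), and ONE (2.38)-shaped inequality
`Σ_{ℓ} G₀ Z ℓ ≤ A_m·e^{−R_m·d(Z)}` on every 𝐃_k (L03 ∧ L03-dom); numeric side: the L03 and window numerics, (R1)–(R3), the rate clause; other rows: W1, W4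
(level `64τe^{−5σ}`), W3 of the step of record; the holder's transport reading.  DISCHARGED: MI-R, L07 (K6 on `measOp`, measurability PROVED), L08a∕b,
L03-geometry, L09 ×2, the insertion structure, R-IDENT's window binders, `ReadLip`.  No displayed binder is refuted for realistic cores (contrast G-ne5p2-5).
NOT a proof of NE5 (the NE5 rate is written `ϰ`). -/
theorem ne5_above_max_record_measOp_letters (hT : (assembly 𝔖.toSlots).TransportReads Set.univ) {W : Set (ℕ → ℝ)}
    (hF : ∀ k, 𝔖.F k = (𝔖.G k).format) {lamR : ℝ}
    {A_m R_m τ σ s E₁ ϰ θ δ δ' c ω Λop Λhist ρ₀ ρ₀' : ℝ}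
    -- numerics of L03 and of the window
    (hA_m : 0 ≤ A_m) (hτ : 0 ≤ τ) (hσ : 0 ≤ σ) (hs0 : 0 ≤ s)
    (hrate : 64 * Real.log 162 + σ + τ * 64 ≤ R_m)
    (hsmall : (1 + s) * A_m * Real.exp (σ * 5 + τ * 64) * B12TreeDecay.K₀ (4 * 2 ^ 4) (2 * 4) * 9 ≤ τ) (hσκ : ϰ + 1 ≤ σ)
    (hrate' : 64 * Real.log 162 + 64 ≤ R_m) (hsmall' : 36 * (A_m * Real.exp 64 * B12TreeDecay.K₀ (4 * 2 ^ 4) (2 * 4)) < 1)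
    -- per catalogued term of record: admissible constants, lattice geometry, B13-format letters; measurability side conditions
    (hadm : ∀ k, ∀ Z ∈ (domainGeometry R).level k, ∀ ℓ ∈ innerLabels (b13InnerData R) k Z, (𝔡 Z ℓ).Admissible)
    (hcore : ∀ k, ∀ Z ∈ (domainGeometry R).level k, ∀ ℓ ∈ innerLabels (b13InnerData R) k Z,
      (termData 𝔖.F 𝔖.G 𝔖.rHist 𝔖.core Z ℓ).GeometryCore (𝔡 Z ℓ))
    (hδ : ∀ k, ∀ Z ∈ (domainGeometry R).level k, ∀ ℓ ∈ innerLabels (b13InnerData R) k Z, (𝔖.G k).δ = (𝔡 Z ℓ).δ)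
    (hvR : ∀ k, ∀ Z ∈ (domainGeometry R).level k, ∀ ℓ ∈ innerLabels (b13InnerData R) k Z, ∀ Y ∈ (𝔖.core Z ℓ).D,
      (𝔖.G k).v Y ≤ lamR * (𝔖.rHist k * (‖(𝔖.G k).τ Y‖ * level136 P.consts (R.carriers.d (dom Y)))))
    (hκL : ∀ k, ∀ Z ∈ (domainGeometry R).level k, ∀ ℓ ∈ innerLabels (b13InnerData R) k Z, 𝔖.rOp k ≤ (𝔡 Z ℓ).κL)
    (hκA : ∀ k, ∀ Z ∈ (domainGeometry R).level k, ∀ ℓ ∈ innerLabels (b13InnerData R) k Z, 𝔖.rOp k ≤ (𝔡 Z ℓ).κA)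
    (hκP : ∀ k, ∀ Z ∈ (domainGeometry R).level k, ∀ ℓ ∈ innerLabels (b13InnerData R) k Z, 𝔖.rOp k ≤ (𝔡 Z ℓ).κP)
    (hκQ : ∀ k, ∀ Z ∈ (domainGeometry R).level k, ∀ ℓ ∈ innerLabels (b13InnerData R) k Z, 𝔖.rOp k ≤ (𝔡 Z ℓ).κQ)
    (hκR : ∀ k, ∀ Z ∈ (domainGeometry R).level k, ∀ ℓ ∈ innerLabels (b13InnerData R) k Z, 𝔖.rOp k * lamR ≤ (𝔡 Z ℓ).κR)
    (hXf : ∀ Z ℓ i, Measurable fun x => (𝔖.core Z ℓ).Xf x i) (hBf : ∀ Z ℓ a, Measurable fun x => (𝔖.core Z ℓ).Bf x a)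
    -- L03: ONE (2.38)-shaped inequality on the summed per-term majorants
    (h238 : ∀ k, ∀ Z ∈ (domainGeometry R).level k,
      ∑ ℓ ∈ innerLabels (b13InnerData R) k Z, G₀ 𝔖 𝔡 Λop Λhist ρ₀ Z ℓ ≤ A_m * Real.exp (-(R_m * R.carriers.d Z)))
    (hρ₁ : ρ₀ ≤ 1)
    -- L06 at BOTH runs' own input points of record
    (hRef : ∀ g ∈ W, ∀ (U : R.carriers.BgB) (X : R.carriers.Dom),
      ∀ Z ∈ (domainGeometry R).level (R.carriers.scale X), ∀ ℓ ∈ innerLabels (b13InnerData R) (R.carriers.scale X) Z,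
        (termData 𝔖.F 𝔖.G 𝔖.rHist 𝔖.core Z ℓ).RefAt (𝔡 Z ℓ) (inputB_KP 𝔖.toSlots E₀ cB g U X))
    (hRefA : ∀ g ∈ W, ∀ (U : R.carriers.BgB) (X : R.carriers.Dom),
      ∀ Z ∈ (domainGeometry R).level (R.carriers.scale X), ∀ ℓ ∈ innerLabels (b13InnerData R) (R.carriers.scale X) Z,
        (termData 𝔖.F 𝔖.G 𝔖.rHist 𝔖.core Z ℓ).RefAt (𝔡 Z ℓ) (inputA_KP 𝔖.toSlots E₀ cB g U X))
    -- W1, W4, W3 of the step of record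
    (hop : (step 𝔖.toSlots E₀ cB).OperatorRate W δ θ)
    (hins : (step 𝔖.toSlots E₀ cB).InsertionRate W ϰ (τ * 64 * Real.exp (-(σ * 5))) δ' θ)
    (hunit : (step 𝔖.toSlots E₀ cB).InsScaleBound W ϰ E₁ c ω)
    -- numerics
    (hE₁ : 0 < E₁) (hΛop : 0 < Λop) (hΛhist : 0 < Λhist) (hρ : max (Λhist / Λop) 1 * ρ₀' ≤ ρ₀)
    (hs : Λhist * ρ₀' < s) (hδ0 : 0 ≤ δ) (hδ' : 0 ≤ δ') (hθ : 0 ≤ θ) (hθ1 : θ < 1)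
    (hc : 0 ≤ c) (hω : 0 < ω) (hω1 : ω < 1)
    (hreach : c * (τ * 64 * Real.exp (-(σ * 5)) + τ * 64 * Real.exp (-(σ * 5))) / (1 - ω) < ρ₀')
    {θ' : ℝ} (hθ' : max θ (ω + (τ * 64 * Real.exp (-(σ * 5))) * Λhist / (s - Λhist * ρ₀') * c) < θ') :
    ∃ C₅, NE5 (outA 𝔖.toSlots E₀ cB) (outB 𝔖.toSlots E₀ cB) W ϰ θ' C₅ := by
  -- `ReadLip` in the term's own-scale margins from the format letters (part 2's `readLip_toTermDatum_signs`), then part 3's END with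
  -- `m := termMajorant`
  have hlip : ∀ k, ∀ Z ∈ (domainGeometry R).level k, ∀ ℓ ∈ innerLabels (b13InnerData R) k Z,
      (termData 𝔖.F 𝔖.G 𝔖.rHist 𝔖.core Z ℓ).ReadLip (𝔡 Z ℓ) (𝔖.rOp (R.carriers.scale Z)) (𝔖.rHist (R.carriers.scale Z)) := by
    intro k Z hZ ℓ hℓ
    have hsc : R.carriers.scale Z = k := ((domainGeometry R).mem_level Z _).1 hZ
    unfold termData
    rw [hsc, hF k]
    exact B13OpMeasurable.readLip_toTermDatum_signs (𝔖.core Z ℓ) (𝔖.G k) (𝔖.rHist k) (𝔡 Z ℓ) (hδ k Z hZ ℓ hℓ) (hvR k Z hZ ℓ hℓ)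
      (𝔖.rOp_pos k) (𝔖.rHist_pos k) (hκL k Z hZ ℓ hℓ) (hκA k Z hZ ℓ hℓ) (hκP k Z hZ ℓ hℓ) (hκQ k Z hZ ℓ hℓ) (hκR k Z hZ ℓ hℓ)
  have hFQ : ∀ k (Y : 𝒴) (b b' : κ), Measurable fun x : Ω => (𝔖.F k).wt (.potQ x Y b b') := fun k Y b b' => by
    simp only [hF k, B13Weights.format_wt, B13Weights.wt]; exact measurable_const
  have hFR : ∀ k (Y : 𝒴), Measurable fun x : Ω => (𝔖.F k).wt (.potR x Y) := fun k Y => by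
    simp only [hF k, B13Weights.format_wt, B13Weights.wt]; exact measurable_const
  have hm : ∀ g ∈ W, ∀ (U : R.carriers.BgB) (k : ℕ), ∀ Z ∈ R.domAt k,
      termMajorant 𝔖 𝔡 Λop Λhist ρ₀ g U Z ≤ A_m * Real.exp (-(R_m * R.carriers.d Z)) := by
    intro g _ U k Z hZ
    have hsc : R.carriers.scale Z = k := ((domainGeometry R).mem_level Z _).1 hZ
    have h := h238 k Z hZ
    unfold termMajorant
    rw [hsc]
    exact h
  exact ne5_above_max_record_measOp 𝔖 E₀ cB hA hB 𝔡 hT hA_m hτ hσ hs0 (termMajorant_nonneg 𝔖 𝔡 hΛop hΛhist hadm) hm hrate hsmall hσκ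
    hrate' hsmall' hadm hcore hlip hXf hBf hFQ hFR (hsum_termMajorant_M 𝔖 E₀ cB hA hB 𝔡 W) hρ₁ hRef hRefA hop hins hunit hE₁ hΛop hΛhist hρ hs
    hδ0 hδ' hθ hθ1 hc hω hω1 hreach hθ'

end Summit.QuantumFields.BalabanUV.T4Continuum.B13KPStepTermMeasurableLetters

end
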